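import Literature.IUT.HodgeTheaters.PiAvatarLocalHoms
import Literature.IUT.HodgeTheaters.PMBaseKit
import HarnessLib

/-!
# KIT-INSTANCE-SPEC P5-binding, ASSEMBLY (IV-a): the genuine base kit `PMBaseKit l` of [IUTchI] §6 at the REAL initial Θ-data, in
# the Π-avatar, from one `LocalDatum` per index — EVERY field, every kit law a theorem ([IUTchI] Def 6.1 (ii)–(vii), Ex 6.3 (i);
# defs — post-freeze additive D13, not a cone member)

S. Mochizuki, *Inter-universal Teichmüller theory I*, kurims manuscript (May 2020), Def 6.1 (ii)–(vii) pp. 156–159 and Ex 6.3 (i) p. 161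
(the printed sentences are quoted field by field in abc-iut-L5-t4's interface `PMBaseKit`, p405271/p414335) ([IUTchI] Def 6.1 (ii)-(vii) pp.156-159)
[claim: Mochizuki2012, status: disputed] (D-0012 claim key, series status DISPUTED — a CONSTRUCTION over abc-iut-L5-t2's REAL `InitialThetaData`
and abc-iut-L5-t1's `CuspGalois`, under the binders listed below; nothing of the series is asserted, no side is taken on [IUTchIII] Cor. 3.12).

## What is built
**`InitialThetaData.baseKitOfData D CG hS hsurj bad arc δ : PMBaseKit.{w} l`** — the kit whose
* global part is the P5-binding of abc-iut-L5-t4 gen 3/4: `Glob`/`gModel`/`gIso` (p423760), `GLab := Cusp(X̲_K)`, `gLabMap := gLabIso`,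
  `toFlStar := toFlStarOf` (p437681), `gLabT`/`gChart₀` (p430475), with the laws `autCsp_le`/`gLab_range` (p436172, p437681) and
  `toFlStar_surjective` from the hypothesis `hsurj : Surjective toFlStarGlobal` (= abc-iut-L5-t8's `toFlStarGlobal_surjective_of_torsionMonodromy M`);
* local part at the index `v` is read off the datum `δ v : D.LocalDatum CG hS` (p442681): `Amb v := (δ v).Amb` (objects in play), `model v`, `pmObj`/`toPM`
  (the CONJUGATE `ℬ(bΠ^±_v̲b⁻¹)⁰ ⊇ ℬ(bΠ_v̲b⁻¹)⁰` of the type-(1,l-tors) object — «contains `π₁(†𝒟_v)` as an open subgroup», Def 6.1 (ii)),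
  `LabCuspPM := Cusp(X̲_K)`, `labPM := {±gChart₀}`, `labMap := labMapAmb`, `atV`, `phiEll`, `labOfHom := labOfHomAmb` (p443751), with the laws
  `labMap_refl/_trans/_charts`, `exists_negative`, `labOfHom_pre/_post`, `labOfHom_phiEll_bijective/_charts` ALL THEOREMS.
BINDERS of record (arguments): `CG` (cusp/Galois DATA of [IUTchI] §1, abc-iut-L5-t1), `hS : CuspClassesNormaliserStable` (G-L5t4g3-3),
`[(D.PiXund.subgroupOf D.PiXK).Normal]` (= t8 `TorsionMonodromy.normal_PiXund_subgroupOf_PiXK`), `hsurj` (= t8, from `TorsionMonodromy`),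
and, inside each `δ v`, the local arrow law `LocalArrowLaw` (G-L5t4g4-1) + a negative element (good `v̲`: abc-iut-L5-t1's `ArrowCoveringClaims`
via `exists_localInvolution`; bad `v̲`: G-L5t4g3-2 (iii)). The index set `V`, `bad`, `arc` are parameters (the place-kit bridge `PlaceKit` supplies
`V ≃ V̲`, p415508) — IV-b wires `δ` to the places. No instance, no notation; typed ≠ proved elsewhere; binder ≠ fact.
-/

noncomputable section

namespace Literature.IUT.HodgeTheaters

open CategoryTheory
open scoped Pointwise

universe u v w

section BaseKit

variable {F : Type u} {K : Type v} {Fbar : Type w} [Field F] [NumberField F] [Field K] [NumberField K]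
  [Algebra F K] [Field Fbar] [Algebra F Fbar] [Algebra K Fbar]
  {E : WeierstrassCurve F} [E.IsElliptic] {l : ℕ} {Pb : BadPlacePredicates K}
  (D : InitialThetaData F K Fbar E l Pb) (CG : D.geom.pe.CuspGalois) (hS : D.CuspClassesNormaliserStable) [Fact l.Prime]

namespace InitialThetaData

namespace LocalDatum

variable {D CG hS} (δ : D.LocalDatum CG hS)

/-! ### The `±`-object of an isomorph of `𝒟_v̲`: the conjugate of `†𝒟_v̲^±` containing it -/

/-- A conjugator `b` of an isomorph `X = ℬ(bΠ_v̲b⁻¹)⁰` of `𝒟_v̲` (`x ∈ Π_v̲ ↔ b x b⁻¹ ∈ X.sub`).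
([IUTchI] Def 4.1 (i) p.95) [claim: Mochizuki2012, status: disputed] -/
theorem exists_conjugator {X : D.PiAmbient} (hX : Nonempty (X ≅ δ.locObj)) : ∃ b : D.PiC, ∀ x, x ∈ δ.H ↔ b * x * b⁻¹ ∈ X.sub :=
  (OrbitCat.nonempty_iso_iff_conjugate X.sub δ.H).mp hX

/-- The chosen conjugator of an isomorph of `𝒟_v̲`. ([IUTchI] Def 4.1 (i) p.95) [claim: Mochizuki2012, status: disputed] -/
def conjugator {X : D.PiAmbient} (hX : Nonempty (X ≅ δ.locObj)) : D.PiC := (δ.exists_conjugator hX).choose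

/-- Its defining property. ([IUTchI] Def 4.1 (i) p.95) [claim: Mochizuki2012, status: disputed] -/
theorem conjugator_spec {X : D.PiAmbient} (hX : Nonempty (X ≅ δ.locObj)) (x : D.PiC) :
    x ∈ δ.H ↔ δ.conjugator hX * x * (δ.conjugator hX)⁻¹ ∈ X.sub :=
  (δ.exists_conjugator hX).choose_spec x

/-- `bΠ^±_v̲b⁻¹` is an isomorph of `†𝒟_v̲^±`. ([IUTchI] Def 6.1 (ii) p.156) [claim: Mochizuki2012, status: disputed] -/
theorem conj_und_mem (b : D.PiC) (x : D.PiC) : x ∈ δ.Hund ↔ b * x * b⁻¹ ∈ MulAut.conj b • δ.Hund := by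
  rw [Subgroup.mem_pointwise_smul_iff_inv_smul_mem, MulAut.smul_def, MulAut.conj_inv_apply]
  simp [mul_assoc]

/-- `X.sub ≤ bΠ^±_v̲b⁻¹` for `X = ℬ(bΠ_v̲b⁻¹)⁰`: «contains `π₁(†𝒟_v)` as an open subgroup» (Def 6.1 (ii)).
([IUTchI] Def 6.1 (ii) p.156) [claim: Mochizuki2012, status: disputed] -/
theorem sub_le_conj_und {X : D.PiAmbient} (hX : Nonempty (X ≅ δ.locObj)) :
    ∀ x ∈ X.sub, (1 : D.PiC)⁻¹ * x * 1 ∈ MulAut.conj (δ.conjugator hX) • δ.Hund := by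
  intro x hx
  rw [inv_one, one_mul, mul_one, Subgroup.mem_pointwise_smul_iff_inv_smul_mem, MulAut.smul_def, MulAut.conj_inv_apply]
  refine δ.le_und ((δ.conjugator_spec hX _).mpr ?_)
  simpa [mul_assoc] using hx

open Classical in
/-- **Kit slots `pmObj`/`toPM` at `v̲`** as one pair: for an isomorph `X = ℬ(bΠ_v̲b⁻¹)⁰` of `𝒟_v̲` the type-(1,l-tors) overgroup object
`†X^± := ℬ(bΠ^±_v̲b⁻¹)⁰` (an object in play, isomorph of `†𝒟_v̲^±`) with the natural morphism `X → †X^±` (Def 6.1 (ii) «which contains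
`π₁(†𝒟_v)` as an open subgroup; … a natural morphism `†𝒟_v → †𝒟_v^±`»); for the other objects in play (not isomorphs of `𝒟_v̲`) the
identity (no printed content). ([IUTchI] Def 6.1 (ii) p.156) [claim: Mochizuki2012, status: disputed] -/
def pmPair (X : δ.Amb) : Σ Y : δ.Amb, (X ⟶ Y) :=
  if hX : Nonempty (X.obj ≅ δ.locObj) then
    ⟨⟨OrbitCat.of (MulAut.conj (δ.conjugator hX) • δ.Hund),
        Or.inr (Or.inl ⟨OrbitCat.isoOfConj (δ.conjugator hX) (δ.conj_und_mem (δ.conjugator hX))⟩)⟩,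
      ObjectProperty.homMk (OrbitCat.homOfElem 1 (δ.sub_le_conj_und hX))⟩
  else ⟨X, 𝟙 X⟩

end LocalDatum

variable [(D.PiXund.subgroupOf D.PiXK).Normal] (hsurj : Function.Surjective D.toFlStarGlobal)
  {V : Type} [DecidableEq V] (bad arc : Finset V) (δ : V → D.LocalDatum CG hS)

/-- **THE GENUINE BASE KIT OF [IUTchI] §6 AT THE INITIAL Θ-DATA** (Π-avatar, design D1 EMBEDDED): every field of abc-iut-L5-t4's interface
`PMBaseKit l` (Def 6.1 (ii)–(vii)) filled from the real `InitialThetaData`, one `LocalDatum` per index; all kit laws are theorems of the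
P5-binding files. Binders: `CG`, `hS`, `[Normal]`, `hsurj`, and the laws inside `δ`. ([IUTchI] Def 6.1 (ii)-(vii) pp.156-159) [claim: Mochizuki2012, status: disputed] -/
def baseKitOfData : PMBaseKit.{w} l where
  V := V
  bad := bad
  arc := arc
  Amb v := (δ v).Amb
  model v := (δ v).model
  pmObj v X := ((δ v).pmPair X).1
  toPM v X := ((δ v).pmPair X).2
  LabCuspPM _ _ := D.geom.pe.Cusp
  labPM _ _ _ := D.gLabPMModel CG
  labMap := fun v {X} {Y} φ => (δ v).labMapAmb (((δ v).InPlay).ι.mapIso φ)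
  labMap_refl v X := by
    rw [Functor.mapIso_refl]
    exact (δ v).labMapAmb_refl _
  labMap_trans := fun v {X} {Y} {Z} φ ψ => by
    change (δ v).labMapAmb (((δ v).InPlay).ι.mapIso (φ ≪≫ ψ)) = _
    rw [Functor.mapIso_trans]
    exact (δ v).labMapAmb_trans _ _
  labMap_charts := fun v {X} {Y} hX _ φ e he =>
    (δ v).labMapAmb_trans_mem_charts ⟨((δ v).InPlay).ι.mapIso hX.some⟩ _ he
  exists_negative v X hX := by
    obtain ⟨α₀, hα₀⟩ := (δ v).exists_labMapAmb_ne_refl (X := X.obj) ⟨((δ v).InPlay).ι.mapIso hX.some⟩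
    refine ⟨((δ v).InPlay).isoMk α₀, ?_⟩
    have h : ((δ v).InPlay).ι.mapIso (((δ v).InPlay).isoMk α₀ : X ≅ X) = α₀ := Iso.ext rfl
    change (δ v).labMapAmb (((δ v).InPlay).ι.mapIso (((δ v).InPlay).isoMk α₀ : X ≅ X)) ≠ _
    rw [h]
    exact hα₀
  Glob := D.Glob
  gModel := D.gModel
  gIso := D.gIso
  GLab := D.GLabOf
  gLabMap := fun {G} {H} φ => D.gLabIso CG hS φ
  gLabMap_refl := D.gLabIso_refl CG hS
  gLabMap_trans := fun {G} {H} {J} φ ψ => D.gLabIso_trans CG hS φ ψ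
  toFlStar := D.toFlStarOf
  toFlStar_surjective := D.toFlStarOf_surjective_of hsurj
  gLabT := D.gLabTModel CG
  gChart₀ := D.gChart₀Model CG
  gChart₀_mem := D.gChart₀Model_mem_charts CG
  autCsp_le := D.autCsp_le_of CG hS
  gLab_range := D.gLab_range_of CG hS
  atV v := (δ v).atV
  phiEll v := (δ v).phiEll
  labOfHom := fun v {X} {G} f => (δ v).labOfHomAmb (G := G) f.hom
  labOfHom_pre := fun v {X} {Y} {G} φ f => (δ v).labOfHomAmb_pre (((δ v).InPlay).ι.mapIso φ) f.hom
  labOfHom_post := fun v {X} {G} {H} f ψ => (δ v).labOfHomAmb_post X.property f.hom ψ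
  labOfHom_phiEll_bijective v := by
    change Function.Bijective ((δ v).labOfHomAmb (G := D.gModel) (δ v).phiEllAmb)
    rw [(δ v).labOfHomAmb_phiEllAmb]
    exact Function.bijective_id
  labOfHom_phiEll_charts v e he := by
    have key : ∀ (g : D.geom.pe.Cusp → D.geom.pe.Cusp) (hb : Function.Bijective g), g = id →
        (Equiv.ofBijective g hb).symm.trans e = e := by
      rintro g hb rfl
      ext x
      change e ((Equiv.ofBijective id hb).symm x) = e x
      congr 1
      exact Equiv.ofBijective_apply_symm_apply id hb x
    have hid : (δ v).labOfHomAmb (G := D.gModel) (δ v).phiEll.hom = id := (δ v).labOfHomAmb_phiEllAmb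
    rw [key _ _ hid]
    exact (D.gLabPMModel CG).mem_toTorsor_charts he

end InitialThetaData

end BaseKit

end Literature.IUT.HodgeTheaters
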